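import Mathlib
import HarnessLib

/-!
# The alternative theorem for strict convex inequality systems (Rockafellar 1970, Theorem 21.1)

Rockafellar, *Convex Analysis* (1970), Section 21 «Helly's Theorem and Systems of Inequalities»,
Theorem 21.1 (p. 186; due to Fan, Glicksberg and Hoffman): for a convex set `C` and finitely many
convex functions `f₁, …, f_m` on `C`, exactly one of the following holds — (a) some `x ∈ C` has
`fᵢ(x) < 0` for every `i`; (b) some multipliers `λᵢ ≥ 0`, not all zero, have
`λ₁ f₁(x) + ⋯ + λ_m f_m(x) ≥ 0` for every `x ∈ C`.  Everything is proved; no new definitions.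

## Encoding (declared deviations from the printed text)

* `C : Set X` in an arbitrary real vector space `X` (no topology on `X` is needed: the separation
  happens in `ℝ^ι`); the index set is a finite type `ι`, non-empty where alternative (b) requires
  "not all zero"; the functions are real-valued `f : ι → X → ℝ` with `ConvexOn ℝ C (f i)` — the
  book's «proper convex with `dom fᵢ ⊇ ri C`» is thus specialised to functions finite and convex on
  `C` itself (the relative-interior refinement is finite-dimensional and not formalised).
* "One and only one" is `not_exists_forall_lt_iff` (`¬(a) ↔ (b)`); the two implications are
  `not_exists_forall_lt_of_multipliers` and `exists_multipliers_of_not_exists_forall_lt`, the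
  latter by the book's argument: the set `{z ∈ ℝ^ι | ∃ x ∈ C, fᵢ(x) < zᵢ ∀ i}` is convex, open,
  closed upwards and misses `0`, so a linear functional negative on it (`geometric_hahn_banach_
  open_point`) has non-positive coordinates, not all zero, and testing it on `(fᵢ(x) + ε)ᵢ` gives
  (b).  A normalised form with `λ` in Mathlib's `stdSimplex ℝ ι` is added.
* NOT formalised: Theorems 21.2–21.5 (mixed systems with affine inequalities and the polyhedral /
  relative-interior refinements) and Helly's theorem 21.6 with its corollaries (Mathlib has
  `Convex.helly_theorem`).

## Main statements (all proved; no named facts, no `sorry`)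

* `not_exists_forall_lt_of_multipliers` — (b) ⇒ ¬(a).
* `exists_multipliers_of_not_exists_forall_lt` — ¬(a) ⇒ (b) (Fan–Glicksberg–Hoffman).
* `not_exists_forall_lt_iff` — Theorem 21.1 as an equivalence.
* `exists_stdSimplex_of_forall_exists_nonneg` — multipliers in the standard simplex.

## References

* R. T. Rockafellar, *Convex Analysis*, Princeton University Press 1970, §21, Theorem 21.1,
  pp. 185–187 (held copy `book:rockafellarnd-convex-analysis`, chunks p0165–p0167; statement on
  p0166).  Key `Rockafellar1970`.
-/

open Set Finset

namespace Literature.Analysis.Convex.ConvexInequalityAlternative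

variable {X : Type*} [AddCommGroup X] [Module ℝ X] {ι : Type*} [Fintype ι]
variable {C : Set X} {f : ι → X → ℝ}

omit [AddCommGroup X] [Module ℝ X] in
/-- **Theorem 21.1**, alternative (b) excludes alternative (a): if non-negative multipliers, not all
zero, make `∑ λᵢ fᵢ ≥ 0` on `C`, then the strict system `fᵢ(x) < 0 (∀ i)` has no solution in `C`.
[cite: Rockafellar1970, §21 Thm 21.1 (held chunk p0166)] -/
theorem not_exists_forall_lt_of_multipliers {l : ι → ℝ} (hl : ∀ i, 0 ≤ l i) (hl0 : l ≠ 0)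
    (h : ∀ x ∈ C, 0 ≤ ∑ i, l i * f i x) : ¬ ∃ x ∈ C, ∀ i, f i x < 0 := by
  classical
  rintro ⟨x, hx, hneg⟩
  obtain ⟨j, hj⟩ : ∃ j, l j ≠ 0 := by
    by_contra hcon
    push Not at hcon
    exact hl0 (funext hcon)
  have hjpos : 0 < l j := lt_of_le_of_ne (hl j) (Ne.symm hj)
  have hsum : ∑ i, l i * f i x = l j * f j x + ∑ i ∈ univ.erase j, l i * f i x :=
    (add_sum_erase univ (fun i => l i * f i x) (mem_univ j)).symm
  have hrest : ∑ i ∈ univ.erase j, l i * f i x ≤ 0 :=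
    sum_nonpos fun i _ => mul_nonpos_of_nonneg_of_nonpos (hl i) (hneg i).le
  have hjneg : l j * f j x < 0 := mul_neg_of_pos_of_neg hjpos (hneg j)
  linarith [h x hx]

/-- **Theorem 21.1 (Fan–Glicksberg–Hoffman)**, the substantial half: if `C` is convex, the
`fᵢ` (`i ∈ ι`, a non-empty finite index set) are convex on `C`, and the strict system
`fᵢ(x) < 0 (∀ i)` has NO solution `x ∈ C`, then there are multipliers `λᵢ ≥ 0`, not all zero,
with `∑ λᵢ fᵢ(x) ≥ 0` for every `x ∈ C`.  (Separation, in `ℝ^ι`, of the open convex set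
`{z | ∃ x ∈ C, fᵢ(x) < zᵢ ∀ i}` from the origin.)
[cite: Rockafellar1970, §21 Thm 21.1 (held chunk p0166)] -/
theorem exists_multipliers_of_not_exists_forall_lt [Nonempty ι] (hC : Convex ℝ C)
    (hf : ∀ i, ConvexOn ℝ C (f i)) (h : ¬ ∃ x ∈ C, ∀ i, f i x < 0) :
    ∃ l : ι → ℝ, (∀ i, 0 ≤ l i) ∧ l ≠ 0 ∧ ∀ x ∈ C, 0 ≤ ∑ i, l i * f i x := by
  classical
  rcases C.eq_empty_or_nonempty with rfl | ⟨x₀, hx₀⟩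
  · refine ⟨fun _ => 1, fun _ => zero_le_one, ?_, fun x hx => hx.elim⟩
    intro h1
    have := congr_fun h1 (Classical.arbitrary ι)
    simp at this
  -- the set of strict upper bounds of the vectors `(fᵢ(x))ᵢ`, `x ∈ C`
  set S : Set (ι → ℝ) := {z | ∃ x ∈ C, ∀ i, f i x < z i} with hS
  have hSconv : Convex ℝ S := by
    refine convex_iff_forall_pos.2 ?_
    rintro z ⟨x, hx, hz⟩ w ⟨y, hy, hw⟩ a b ha hb hab
    refine ⟨a • x + b • y, hC hx hy ha.le hb.le hab, fun i => ?_⟩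
    have hconv := (hf i).2 hx hy ha.le hb.le hab
    have h1 : a * f i x < a * z i := mul_lt_mul_of_pos_left (hz i) ha
    have h2 : b * f i y < b * w i := mul_lt_mul_of_pos_left (hw i) hb
    simp only [smul_eq_mul, Pi.add_apply, Pi.smul_apply] at hconv ⊢
    linarith
  have hSopen : IsOpen S := by
    have : S = ⋃ x ∈ C, Set.pi Set.univ fun i => Set.Ioi (f i x) := by
      ext z
      simp only [hS, Set.mem_setOf_eq, Set.mem_iUnion, Set.mem_pi, Set.mem_univ, Set.mem_Ioi,
        forall_true_left, exists_prop]
    rw [this]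
    exact isOpen_biUnion fun x _ => isOpen_set_pi Set.finite_univ fun i _ => isOpen_Ioi
  have h0 : (0 : ι → ℝ) ∉ S := fun ⟨x, hx, hz⟩ => h ⟨x, hx, fun i => by simpa using hz i⟩
  -- upward closed
  have hSup : ∀ z ∈ S, ∀ w : ι → ℝ, z ≤ w → w ∈ S := fun z ⟨x, hx, hz⟩ w hzw =>
    ⟨x, hx, fun i => lt_of_lt_of_le (hz i) (hzw i)⟩
  obtain ⟨φ, hφ⟩ := geometric_hahn_banach_open_point hSconv hSopen h0
  rw [map_zero] at hφ
  -- coordinates of `φ`: `φ(z) = ∑ᵢ zᵢ cᵢ` with `cᵢ = φ(eᵢ)`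
  have hφsum : ∀ z : ι → ℝ, φ z = ∑ i, z i * φ (Pi.single i 1) := by
    intro z
    have := LinearMap.pi_apply_eq_sum_univ (φ : (ι → ℝ) →ₗ[ℝ] ℝ) z
    simp only [ContinuousLinearMap.coe_coe, smul_eq_mul] at this
    rw [this]
    refine sum_congr rfl fun i _ => ?_
    congr 2
    funext j
    simp [Pi.single_apply, eq_comm]
  -- a point of `S`
  set z₀ : ι → ℝ := fun i => f i x₀ + 1 with hz₀def
  have hz₀ : z₀ ∈ S := ⟨x₀, hx₀, fun i => by simp [hz₀def]⟩
  have hφz₀ : φ z₀ < 0 := hφ z₀ hz₀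
  -- every coordinate of `φ` is `≤ 0`, since `S` is closed upwards
  have hcle : ∀ i, φ (Pi.single i 1) ≤ 0 := by
    intro i
    by_contra hpos
    push Not at hpos
    have htpos : 0 < (|φ z₀| + 1) / φ (Pi.single i 1) := div_pos (by positivity) hpos
    have hmem : z₀ + ((|φ z₀| + 1) / φ (Pi.single i 1)) • Pi.single i (1 : ℝ) ∈ S := by
      refine hSup z₀ hz₀ _ fun j => ?_
      simp only [Pi.add_apply, Pi.smul_apply, smul_eq_mul, le_add_iff_nonneg_right]
      refine mul_nonneg htpos.le ?_
      rw [Pi.single_apply]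
      split_ifs <;> norm_num
    have hlt := hφ _ hmem
    rw [map_add, map_smul, smul_eq_mul, div_mul_cancel₀ _ hpos.ne'] at hlt
    linarith [neg_abs_le (φ z₀)]
  refine ⟨fun i => -φ (Pi.single i 1), fun i => neg_nonneg.2 (hcle i), ?_, fun x hx => ?_⟩
  · -- not all multipliers vanish: otherwise `φ = 0`, contradicting `φ(z₀) < 0`
    intro hzero
    have hci : ∀ i, φ (Pi.single i 1) = 0 := fun i => by
      have := congr_fun hzero i
      simpa using this
    have : φ z₀ = 0 := by rw [hφsum]; simp [hci]
    linarith
  · -- the inequality `∑ λᵢ fᵢ(x) ≥ 0`: test `φ` on `(fᵢ(x) + ε)ᵢ ∈ S` and let `ε ↓ 0`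
    set M : ℝ := -∑ i, φ (Pi.single i 1) with hM
    have hM0 : 0 ≤ M := by
      rw [hM, neg_nonneg]; exact sum_nonpos fun i _ => hcle i
    set δ : ℝ := ∑ i, f i x * φ (Pi.single i 1) with hδ
    have hε : ∀ ε : ℝ, 0 < ε → δ < ε * M := by
      intro ε hε
      have hmem : (fun i => f i x + ε) ∈ S := ⟨x, hx, fun i => by linarith⟩
      have hlt := hφ _ hmem
      rw [hφsum] at hlt
      have hsplit : ∑ i, (f i x + ε) * φ (Pi.single i 1) = δ + ε * ∑ i, φ (Pi.single i 1) := by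
        rw [hδ, mul_sum, ← sum_add_distrib]
        exact sum_congr rfl fun i _ => by ring
      rw [hsplit] at hlt
      rw [hM, mul_neg]
      linarith
    have hδle : δ ≤ 0 := by
      by_contra hpos
      push Not at hpos
      have h1 := hε (δ / (M + 1)) (div_pos hpos (by linarith))
      have h2 : δ / (M + 1) * M < δ := by
        rw [div_mul_eq_mul_div, div_lt_iff₀ (by linarith : (0 : ℝ) < M + 1)]
        nlinarith
      linarith
    have hrw : ∑ i, -φ (Pi.single i 1) * f i x = -δ := by
      rw [hδ, ← sum_neg_distrib]
      exact sum_congr rfl fun i _ => by ring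
    rw [hrw]
    linarith

/-- **Theorem 21.1**: exactly one of the alternatives (a) `∃ x ∈ C, fᵢ(x) < 0 ∀ i` and
(b) `∃ λ ≥ 0, λ ≠ 0, ∑ λᵢ fᵢ ≥ 0 on C` holds — stated as `¬(a) ↔ (b)`.
[cite: Rockafellar1970, §21 Thm 21.1 (held chunk p0166)] -/
theorem not_exists_forall_lt_iff [Nonempty ι] (hC : Convex ℝ C) (hf : ∀ i, ConvexOn ℝ C (f i)) :
    (¬ ∃ x ∈ C, ∀ i, f i x < 0) ↔
      ∃ l : ι → ℝ, (∀ i, 0 ≤ l i) ∧ l ≠ 0 ∧ ∀ x ∈ C, 0 ≤ ∑ i, l i * f i x :=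
  ⟨exists_multipliers_of_not_exists_forall_lt hC hf,
    fun ⟨_, hl, hl0, h⟩ => not_exists_forall_lt_of_multipliers hl hl0 h⟩

/-- **Theorem 21.1**, normalised multipliers: if for every `x ∈ C` some `fᵢ(x) ≥ 0` (i.e. the
strict system is inconsistent on `C`), then some `λ` in the standard simplex has
`∑ λᵢ fᵢ(x) ≥ 0` for all `x ∈ C`. [cite: Rockafellar1970, §21 Thm 21.1 (held chunk p0166)] -/
theorem exists_stdSimplex_of_forall_exists_nonneg [Nonempty ι] (hC : Convex ℝ C)
    (hf : ∀ i, ConvexOn ℝ C (f i)) (h : ∀ x ∈ C, ∃ i, 0 ≤ f i x) :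
    ∃ l ∈ stdSimplex ℝ ι, ∀ x ∈ C, 0 ≤ ∑ i, l i * f i x := by
  have h' : ¬ ∃ x ∈ C, ∀ i, f i x < 0 := fun ⟨x, hx, hlt⟩ => by
    obtain ⟨i, hi⟩ := h x hx
    exact absurd (hlt i) (not_lt.2 hi)
  obtain ⟨l, hl, hl0, hle⟩ := exists_multipliers_of_not_exists_forall_lt hC hf h'
  have hspos : 0 < ∑ i, l i := by
    obtain ⟨j, hj⟩ : ∃ j, l j ≠ 0 := by
      by_contra hcon
      push Not at hcon
      exact hl0 (funext hcon)
    exact lt_of_lt_of_le (lt_of_le_of_ne (hl j) (Ne.symm hj))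
      (single_le_sum (fun i _ => hl i) (mem_univ j))
  refine ⟨fun i => l i / ∑ j, l j, ⟨fun i => div_nonneg (hl i) hspos.le, ?_⟩, fun x hx => ?_⟩
  · rw [← sum_div, div_self hspos.ne']
  · have : ∑ i, l i / (∑ j, l j) * f i x = (∑ i, l i * f i x) / ∑ j, l j := by
      rw [sum_div]
      exact sum_congr rfl fun i _ => by ring
    rw [this]
    exact div_nonneg (hle x hx) hspos.le

end Literature.Analysis.Convex.ConvexInequalityAlternative
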